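import Literature.NumberTheory.Automorphic.GaloisActionPlaces
import Literature.NumberTheory.GaloisRepresentations.ArtinFormalismInductionProofs
import Literature.NumberTheory.GaloisRepresentations.DegreeOneFrobeniusDensity
import HarnessLib

/-!
# Places of residue degree one fixed by a nontrivial automorphism are finite in number
# (so degree-one places are split off a finite set, and Frobenii at split places are dense)

Topic `NumberTheory/Automorphic` (Galois action on finite places, as `GaloisActionPlaces`); namespace
`Literature.NumberTheory.Automorphic`.  A *proofs* file (theorems only; no definition, no named fact, no
instance).

Let `E/F` be an extension of number fields and `σ ∈ Aut(E/F)`, `σ ≠ 1`.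

* `smul_sub_mem_asIdeal_of_smul_eq_of_inertiaDeg_eq_one` — if `σ` FIXES the finite place `w` of `E` and
  `w` has residue degree `f(w | w ∩ 𝓞 F) = 1`, then `σ` acts trivially on the residue field:
  `σ x − x ∈ 𝔭_w` for every `x ∈ 𝓞 E` (the residue field of `w` is that of `v = w ∩ 𝓞 F`, on which `σ`
  is the identity).
* `finite_setOf_smul_eq_and_inertiaDeg_eq_one` — hence only FINITELY many places of residue degree one
  are fixed by `σ` (they all divide `σ x₀ − x₀ ≠ 0` for a fixed `x₀ ∈ 𝓞 E` moved by `σ`); equivalently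
  `eventually_smul_ne_of_inertiaDeg_eq_one`: all but finitely many degree-one places are MOVED by `σ`.
  For `E/F` quadratic with `c` the nontrivial automorphism this says: the degree-one places are, off a
  finite set, exactly the SPLIT places `c • w ≠ w` (the converse «split ⇒ `e = f = 1`» is
  `ramificationIdx_eq_one_and_inertiaDeg_eq_one_of_smul_ne`, `AdicCompletionDegreeOnePlaceEquiv`).
* `absoluteGaloisGroup.frobenius_dense_smul_ne` — consequently the arithmetic Frobenius elements at the
  places `w` with `σ • w ≠ w`, outside any finite `T`, are DENSE in `Γ_E`
  (`GaloisRepresentations.absoluteGaloisGroup.frobenius_dense_of_eventually_inertiaDeg_one_mem`,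
  `DegreeOneFrobeniusDensity`).

Consumer: step 3 of the d6 line card (`Cruxes/HLiu418/Lines/d6_cm_curve`): the congruence relation
[Liu2021 Cor. D.9] and the split-place model [Liu2021 Lem. D.1] (`localPiSplitEquiv … (hw : c • w ≠ w)`) are
stated at the SPLIT places of the CM field `F` over `F⁺`; this file is the `hP` of
`HeckeCharacter.IsAlgebraic.eq_or_eq_of_valueAtUniformizer_of_dense` for that place set.

## References
* A. Fröhlich, M. Taylor, *Algebraic number theory* (1991), Ch. III §1 Thm. 20 (`(L:K) = efg`), proof of Thm. 21. [FrohlichTaylor1990]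
* J. Neukirch, *Algebraic Number Theory* (1999), Ch. I §9 (9.4) (decomposition group → automorphisms of the residue field). [NeukirchANT1999]
* Y. Liu, *Fourier–Jacobi cycles and arithmetic relative trace formula* (2021), App. D, proof of Thm. D.6 (1) (l. 5619: «𝔮 has degree 1 over F»). [Liu2021]
-/

noncomputable section

open scoped NumberField Pointwise
open NumberField IsDedekindDomain Filter

namespace Literature.NumberTheory.Automorphic

section Fixed

variable (F : Type*) [Field F] [NumberField F] {E : Type*} [Field E] [NumberField E] [Algebra F E]

/-- **An automorphism fixing a place of residue degree one acts trivially on its residue field**: if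
`σ • w = w` and `f(w | w ∩ 𝓞 F) = 1` then `σ x − x ∈ 𝔭_w` for all `x ∈ 𝓞 E` (every residue class of `w`
is represented by an element of `𝓞 F`, fixed by `σ`). [cite: NeukirchANT1999, Ch. I §9 (9.4)] -/
theorem smul_sub_mem_asIdeal_of_smul_eq_of_inertiaDeg_eq_one (σ : E ≃ₐ[F] E)
    {w : HeightOneSpectrum (𝓞 E)} (hfix : σ • w = w) (hf : w.asIdeal.inertiaDeg (𝓞 F) = 1)
    (x : 𝓞 E) : σ • x - x ∈ w.asIdeal := by
  classical
  set v : HeightOneSpectrum (𝓞 F) := w.under (𝓞 F) with hv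
  have hwv : w.asIdeal.under (𝓞 F) = v.asIdeal := rfl
  haveI : w.asIdeal.LiesOver v.asIdeal := ⟨hwv.symm⟩
  -- the residue map `𝓞 F ⧸ v → 𝓞 E ⧸ w` is injective between finite sets of the same size
  haveI : Finite (𝓞 F ⧸ v.asIdeal) := v.asIdeal.finiteQuotientOfFreeOfNeBot v.ne_bot
  haveI : Finite (𝓞 E ⧸ w.asIdeal) := w.asIdeal.finiteQuotientOfFreeOfNeBot w.ne_bot
  have hcard : Nat.card (𝓞 E ⧸ w.asIdeal) = Nat.card (𝓞 F ⧸ v.asIdeal) := by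
    rw [← HeightOneSpectrum.residueCard_eq_card_quotient, ← HeightOneSpectrum.residueCard_eq_card_quotient,
      GaloisRepresentations.residueCard_eq_pow_inertiaDeg_of_under_eq hwv, hf, pow_one]
  have hinj : Function.Injective (algebraMap (𝓞 F ⧸ v.asIdeal) (𝓞 E ⧸ w.asIdeal)) :=
    Ideal.algebraMap_quotient_injective
  have hbij := hinj.bijective_of_nat_card_le hcard.le
  -- so `x ≡ r (mod w)` for some `r ∈ 𝓞 F`
  obtain ⟨rbar, hr⟩ := hbij.2 (Ideal.Quotient.mk w.asIdeal x)
  obtain ⟨r, rfl⟩ := Ideal.Quotient.mk_surjective rbar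
  have hxr : x - algebraMap (𝓞 F) (𝓞 E) r ∈ w.asIdeal := by
    rw [← Ideal.Quotient.eq, ← hr]
    rfl
  -- `σ` fixes `r` and maps `𝔭_w` to itself
  have hσxr : σ • (x - algebraMap (𝓞 F) (𝓞 E) r) ∈ w.asIdeal := by
    have := (HeightOneSpectrum.smul_mem_smul_asIdeal_iff σ w (x - algebraMap (𝓞 F) (𝓞 E) r)).2 hxr
    rwa [hfix] at this
  have key : σ • x - x = σ • (x - algebraMap (𝓞 F) (𝓞 E) r) - (x - algebraMap (𝓞 F) (𝓞 E) r) := by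
    rw [smul_sub, smul_algebraMap]
    abel
  rw [key]
  exact w.asIdeal.sub_mem hσxr hxr

omit [NumberField F] in
/-- A nontrivial `F`-automorphism of `E` moves some algebraic integer («given `δ ∈ Δ_w ∖ 1`, we can find `l ∈ L`
such that `l^δ ≠ l`», here with `l` integral). [cite: FrohlichTaylor1990, Ch. III §1, proof of Thm. 21] -/
theorem exists_smul_ne_of_ne_one {σ : E ≃ₐ[F] E} (hσ : σ ≠ 1) : ∃ x : 𝓞 E, σ • x ≠ x := by
  by_contra h
  push Not at h
  apply hσ
  refine AlgEquiv.ext fun y => ?_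
  obtain ⟨a, b, hb, rfl⟩ := IsFractionRing.div_surjective (A := 𝓞 E) y
  have ha : σ (algebraMap (𝓞 E) E a) = algebraMap (𝓞 E) E a := by
    have := congrArg (fun z : 𝓞 E => (z : E)) (h a)
    rwa [RingOfIntegers.coe_algEquiv_smul] at this
  have hb' : σ (algebraMap (𝓞 E) E b) = algebraMap (𝓞 E) E b := by
    have := congrArg (fun z : 𝓞 E => (z : E)) (h b)
    rwa [RingOfIntegers.coe_algEquiv_smul] at this
  rw [AlgEquiv.one_apply, map_div₀, ha, hb']

/-- **Only finitely many places of residue degree one are fixed by a nontrivial automorphism**: they all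
contain `σ x₀ − x₀ ≠ 0` for an `x₀ ∈ 𝓞 E` moved by `σ`.  For `E/F` quadratic: all but finitely many
degree-one places are split. [cite: FrohlichTaylor1990, Ch. III §1 Thm. 20] [cite: NeukirchANT1999, Ch. I §9 (9.4)] -/
theorem finite_setOf_smul_eq_and_inertiaDeg_eq_one {σ : E ≃ₐ[F] E} (hσ : σ ≠ 1) :
    {w : HeightOneSpectrum (𝓞 E) | σ • w = w ∧ w.asIdeal.inertiaDeg (𝓞 F) = 1}.Finite := by
  obtain ⟨x₀, hx₀⟩ := exists_smul_ne_of_ne_one F hσ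
  have hd : (σ • x₀ - x₀ : 𝓞 E) ≠ 0 := sub_ne_zero.mpr hx₀
  have hI : (Ideal.span {σ • x₀ - x₀} : Ideal (𝓞 E)) ≠ ⊥ := by
    rwa [Ne, Ideal.span_singleton_eq_bot]
  refine (Ideal.finite_factors hI).subset fun w hw => ?_
  simp only [Set.mem_setOf_eq] at hw ⊢
  rw [Ideal.dvd_iff_le, Ideal.span_singleton_le_iff_mem]
  exact smul_sub_mem_asIdeal_of_smul_eq_of_inertiaDeg_eq_one F σ hw.1 hw.2 x₀

/-- **All but finitely many degree-one places are moved by `σ ≠ 1`** (cofinite filter form).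
[cite: FrohlichTaylor1990, Ch. III §1 Thm. 20] -/
theorem eventually_smul_ne_of_inertiaDeg_eq_one {σ : E ≃ₐ[F] E} (hσ : σ ≠ 1) :
    ∀ᶠ w : HeightOneSpectrum (𝓞 E) in cofinite, w.asIdeal.inertiaDeg (𝓞 F) = 1 → σ • w ≠ w := by
  refine (finite_setOf_smul_eq_and_inertiaDeg_eq_one F hσ).compl_mem_cofinite |> Filter.mem_of_superset
    <| fun w hw hf hfix => hw ⟨hfix, hf⟩

end Fixed

section Density

variable (F E : Type) [Field F] [NumberField F] [Field E] [NumberField E] [Algebra F E]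

/-- **Frobenii at the places moved by a nontrivial automorphism are dense in `Γ_E`.**  For `σ ∈ Aut(E/F)`,
`σ ≠ 1`, and every finite set `T` of places of `E`, the arithmetic Frobenius elements at primes above places
`w ∉ T` with `σ • w ≠ w` form a dense subset of `Γ_E` — the places of residue degree one over `F` are moved
by `σ` off a finite set (`eventually_smul_ne_of_inertiaDeg_eq_one`), and Frobenii at degree-one places are
dense (`GaloisRepresentations.absoluteGaloisGroup.frobenius_dense_of_eventually_inertiaDeg_one_mem`).  For
a CM field `E = F(√−d)` over `F = E⁺` and `σ = c`: Frobenii at the SPLIT places are dense — the `hP` of the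
d6 card's step 3. [cite: Liu2021, Thm. D.6 (1) proof l. 5619–5624] [cite: FrohlichTaylor1990, Ch. III §1 Thm. 20] -/
theorem absoluteGaloisGroup.frobenius_dense_smul_ne {σ : E ≃ₐ[F] E} (hσ : σ ≠ 1)
    (T : Set (HeightOneSpectrum (𝓞 E))) (hT : T.Finite) :
    Dense {τ : Field.absoluteGaloisGroup E | ∃ w : HeightOneSpectrum (𝓞 E), σ • w ≠ w ∧ w ∉ T ∧
      ∃ 𝔔 ∈ w.primesAbove, IsArithFrobAt (𝓞 E) τ 𝔔} :=
  GaloisRepresentations.absoluteGaloisGroup.frobenius_dense_of_eventually_inertiaDeg_one_mem F E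
    (P := {w | σ • w ≠ w}) (eventually_smul_ne_of_inertiaDeg_eq_one F hσ) T hT

end Density

end Literature.NumberTheory.Automorphic

end
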